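import Summits.NavierStokesRegularity.NavierStokesRegularity.Theorems.IntenseSetDoorsDefs
import Summits.NavierStokesRegularity.NavierStokesRegularity.Theorems.CriticalCoherenceDoorDepletion
import Literature.Analysis.FluidPDE.NearBeltramiEnstrophyCriterion
import Literature.Analysis.FluidPDE.ConstantinFeffermanStretching
import Literature.Analysis.FluidPDE.TaoEnstrophyLocalisationProofs
import Literature.Analysis.FluidPDE.EnstrophyGronwall
import Literature.Analysis.FluidPDE.WholeSpaceIBP
import HarnessLib

/-!
# S34 «IntenseSetDoors» — plate L34 «LambPairingBound» (Lamb-form pairing on the cut vorticity)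

Summits-side proof file (theorems only) for door family S34 of the `NoTypeII` door programme
(nsreg-p1 g28, ROUND-32; texts of record `r32/Sketch34.lean` sha16 c542dddc314f2f7c = tree P0
`Theorems/IntenseSetDoorsDefs.lean`, p640782): `lambPairingBound_holds : LambPairingBound` BY NAME.
For `η > 0` there is `C = 2κ(1 + C_r(1+η)/η)` (`κ = ‖curlCLM‖`, `C_r` the gradient constant of
`radialCutoff`) such that for every level `L > 0` and every admissible `v` (`C²`, divergence free,
`v, ∇v, ∇²v ∈ L²`, `∇²v` bounded), `ω = curl v`, `θ = 1 − radialCutoff L ((1+η)L) ∘ ω`: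
`2∫ θ⟪ω,(∇v)ω⟫ ≤ C ‖∇ω‖_{L²_F} ‖v × ω‖_{L²({|ω| > L})}`. Mechanism = Farhat–Grujić 2019 §2 (Lamb
form, curl onto the cut vorticity) at an arbitrary level on `ℝ³` with a smooth VALUE cut-off.

Proof: with `Z = θω` (the tree's x-high part: `C¹`, compactly supported, layer gradient bound
`‖∇Z‖ ≤ (1 + C_r(1+η)/η)‖∇ω‖` — the level cancels), `θ⟪ω,(∇v)ω⟫ = ⟪Z,(v·∇)ω⟫ − ⟪Z, curl(ω × v)⟫`
(`curl_cross_apply`); the transport term is `∂_v H` for the compactly supported `C¹` primitive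
`H = φ(|ω|²)`, `φ(s) = ∫₀ˢ (1 − cutoffProfile)/2`, so it integrates to `∫ div(Hv) = 0`; the curl is
self-adjoint against `Z`; `curl Z = 0` on `{|ω| ≤ L}` (`ω(y)` is a maximum point of the cut-off),
`‖curl Z‖ ≤ κ(1 + C_r(1+η)/η)‖∇ω‖`, Cauchy–Schwarz on `{|ω| > L}`, `‖∇ω‖²_op ≤ |∇ω|²_F`.
HONEST FRAME: a fixed-time inequality (helper toward S34, item 0056 `NoTypeII`); NS regularity /
0056 NOT claimed.

Tree search (used): `contDiff_xHighPart`, `hasCompactSupport_xHighPart`, `norm_fderiv_xHighPart_le`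
(`CriticalCoherenceDoorDepletion`), `exists_norm_fderiv_radialCutoff_le_div`, `radialCutoff_*`,
`cutoffProfile_*`, `tendsto_curl_cocompact`, `curl_cross_apply`,
`FarhatGrujic2018.integral_inner_curl_eq_integral_inner_curl_of_integrable`,
`integral_divergence_eq_zero`, `divergence_smul_apply`, `divergence_curl_eq_zero_holds`,
`norm_curl_le`, `curl_eq_curlCLM`, `fderiv_curl`, `cross_swap`, `sq_opNorm_le_frobeniusNormSq`,
`frobeniusNormSq_le_three_mul`. Mathlib: `IsLocalMax.fderiv_eq_zero`,
`Continuous.integral_hasStrictDerivAt`, `contDiff_one_iff_deriv`, `HasFDerivAt.norm_sq`,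
`integral_mul_le_Lp_mul_Lq_of_nonneg`.
References: [FarhatGrujic2018] A. Farhat, Z. Grujić, J. Nonlinear Sci. 29 (2019) 803–812,
arXiv:1804.08238, §2; [MajdaBertozziCUP2002] §1.1 (vector identities).
-/

noncomputable section

set_option linter.dupNamespace false

open MeasureTheory Set Function Filter Metric Real InnerProductSpace
open _root_.Topology
open scoped ENNReal NNReal RealInnerProductSpace ContDiff
open Literature.Analysis Literature.Analysis.FluidPDE
open Summit.NavierStokesRegularity.NavierStokesRegularity.Theorems.CriticalCoherenceDoor

namespace Summit.NavierStokesRegularity.NavierStokesRegularity.Theorems.IntenseSetDoors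

-- nested operator types (second derivatives)
set_option maxSynthPendingDepth 3

/-! ### §1 Pointwise tools for the value cut-off -/

/-- The gradient of the radial cut-off `θ_{r₀,r₁}` vanishes on the closed ball of radius `r₀`
(there `θ = 1 = max θ`). [folklore] -/
theorem fderiv_radialCutoff_eq_zero_of_norm_le {r₀ r₁ : ℝ} (h₀ : 0 ≤ r₀) (h₁ : r₀ < r₁)
    {z : EuclideanSpace ℝ (Fin 3)} (hz : ‖z‖ ≤ r₀) :
    fderiv ℝ (radialCutoff r₀ r₁ : EuclideanSpace ℝ (Fin 3) → ℝ) z = 0 := by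
  have hmax : IsLocalMax (radialCutoff r₀ r₁ : EuclideanSpace ℝ (Fin 3) → ℝ) z :=
    Filter.Eventually.of_forall fun w => by
      rw [radialCutoff_eq_one h₀ h₁ hz]
      exact radialCutoff_le_one _ _ _
  exact hmax.fderiv_eq_zero

/-- `cross 0 b = 0`. [folklore] -/
theorem cross_zero_left (b : EuclideanSpace ℝ (Fin 3)) : cross (0 : EuclideanSpace ℝ (Fin 3)) b = 0 := by
  rw [← crossCLM_apply, map_zero]
  simp

/-- A super-level set `{a < |w|}` (`a > 0`) of a field tending to `0` at infinity lies in a compact set.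
[folklore] -/
theorem exists_isCompact_superlevel_subset {w : EuclideanSpace ℝ (Fin 3) → EuclideanSpace ℝ (Fin 3)}
    (hw0 : Tendsto w (cocompact (EuclideanSpace ℝ (Fin 3))) (𝓝 0)) {a : ℝ} (ha : 0 < a) :
    ∃ t : Set (EuclideanSpace ℝ (Fin 3)), IsCompact t ∧ {x | a < ‖w x‖} ⊆ t := by
  have hev : ∀ᶠ y in cocompact (EuclideanSpace ℝ (Fin 3)), ‖w y‖ < a := by
    have h := Metric.tendsto_nhds.1 hw0 a ha
    filter_upwards [h] with y hy
    simpa [dist_zero_right] using hy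
  obtain ⟨t, ht, hts⟩ := mem_cocompact.1 hev
  refine ⟨t, ht, fun y hy => ?_⟩
  by_contra hyt
  have h1 : ‖w y‖ < a := hts hyt
  have h2 : a < ‖w y‖ := hy
  exact lt_asymm h1 h2

/-- The curl of the x-high part `Z = (1 − θ_{a,b}(w)) w` of a `C¹` field vanishes where `|w| ≤ a`
(`0 ≤ a < b`): there `1 − θ(w y) = 0` and `∇θ(w y) = 0`. [folklore] -/
theorem curl_xHighPart_eq_zero_of_norm_le {w : EuclideanSpace ℝ (Fin 3) → EuclideanSpace ℝ (Fin 3)}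
    (hw : ContDiff ℝ 1 w) {a b : ℝ} (ha : 0 ≤ a) (hab : a < b) {y : EuclideanSpace ℝ (Fin 3)}
    (hy : ‖w y‖ ≤ a) : curl (fun y => (1 - radialCutoff a b (w y)) • w y) y = 0 := by
  have hθ : ContDiff ℝ 1 (radialCutoff a b : (EuclideanSpace ℝ (Fin 3)) → ℝ) := radialCutoff_contDiff a b
  have hwd : DifferentiableAt ℝ w y := (hw.differentiable one_ne_zero) y
  have hθd : DifferentiableAt ℝ (radialCutoff a b : (EuclideanSpace ℝ (Fin 3)) → ℝ) (w y) :=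
    (hθ.differentiable one_ne_zero) _
  have hcomp : HasFDerivAt (fun y => radialCutoff a b (w y))
      ((fderiv ℝ (radialCutoff a b : (EuclideanSpace ℝ (Fin 3)) → ℝ) (w y)).comp (fderiv ℝ w y)) y :=
    hθd.hasFDerivAt.comp y hwd.hasFDerivAt
  rw [fderiv_radialCutoff_eq_zero_of_norm_le ha hab hy, ContinuousLinearMap.zero_comp] at hcomp
  have hfac : HasFDerivAt (fun y => 1 - radialCutoff a b (w y)) (0 : EuclideanSpace ℝ (Fin 3) →L[ℝ] ℝ) y := by
    have h2 := (hasFDerivAt_const (1 : ℝ) y).sub hcomp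
    rwa [sub_zero] at h2
  have hprod := hfac.fun_smul hwd.hasFDerivAt
  have h0 : 1 - radialCutoff a b (w y) = 0 := by rw [radialCutoff_eq_one ha hab hy, sub_self]
  rw [curl_eq_curlCLM, hprod.fderiv, h0, zero_smul, zero_add, ContinuousLinearMap.zero_smulRight,
    map_zero]

/-- Cauchy–Schwarz for non-negative square-integrable real functions. [folklore] -/
theorem integral_mul_le_sqrt_mul_sqrt' {f g : EuclideanSpace ℝ (Fin 3) → ℝ}
    (hf0 : ∀ x, 0 ≤ f x) (hg0 : ∀ x, 0 ≤ g x) (hf : MemLp f 2 volume) (hg : MemLp g 2 volume) :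
    ∫ x, f x * g x ≤ Real.sqrt (∫ x, f x ^ 2) * Real.sqrt (∫ x, g x ^ 2) := by
  have e2 : ENNReal.ofReal 2 = (2 : ℝ≥0∞) := by norm_num
  have hf' : MemLp f (ENNReal.ofReal 2) volume := by rw [e2]; exact hf
  have hg' : MemLp g (ENNReal.ofReal 2) volume := by rw [e2]; exact hg
  have h := integral_mul_le_Lp_mul_Lq_of_nonneg Real.HolderConjugate.two_two
    (Eventually.of_forall hf0) (Eventually.of_forall hg0) hf' hg'
  simp only [Real.rpow_two] at h
  rwa [Real.sqrt_eq_rpow, Real.sqrt_eq_rpow]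

/-! ### §2 The transport term against the cut vorticity vanishes -/

/-- **The transport term integrates to zero against the cut vorticity**: for a divergence-free `C²`
field `v` with `∇v ∈ L²` and `∇²v` bounded, `ω = curl v`, and radii `0 < a < b`,
`∫ ⟪(1 − θ_{a,b}(ω)) ω, (v·∇)ω⟫ = 0`. Indeed the integrand is `∂_v H` for the compactly supported
`C¹` primitive `H = φ(|ω|²)`, `φ(s) = ∫₀ˢ (1 − cutoffProfile a b r)/2 dr` (`φ = 0` on `(−∞, a²]`,
`{|ω| > a}` is relatively compact), and `∫ ∂_v H = ∫ div (H v) = 0`. [folklore] -/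
theorem integral_inner_xHighPart_convect_eq_zero
    {v : EuclideanSpace ℝ (Fin 3) → EuclideanSpace ℝ (Fin 3)} (hv : ContDiff ℝ 2 v)
    (hdiv : VectorCalculus.IsDivFree v) (hG : Integrable fun x => ‖fderiv ℝ v x‖ ^ 2) {B : ℝ}
    (hB : ∀ x, ‖fderiv ℝ (fderiv ℝ v) x‖ ≤ B) {a b : ℝ} (ha : 0 < a) (hab : a < b) :
    ∫ x, ⟪(1 - radialCutoff a b (curl v x)) • curl v x, convect v (curl v) x⟫ = 0 := by
  have hv1 : ContDiff ℝ 1 v := hv.of_le (by norm_num)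
  have hω1 : ContDiff ℝ 1 (curl v) := contDiff_curl (n := 1) (by exact hv)
  set φ : ℝ → ℝ := fun s => ∫ r in (0 : ℝ)..s, (1 - cutoffProfile a b r) / 2 with hφ
  have hgc : Continuous fun r : ℝ => (1 - cutoffProfile a b r) / 2 :=
    (continuous_const.sub (cutoffProfile_contDiff a b (n := 0)).continuous).div_const _
  have hφd : ∀ s, HasDerivAt φ ((1 - cutoffProfile a b s) / 2) s := fun s =>
    (hgc.integral_hasStrictDerivAt 0 s).hasDerivAt
  have hφ0 : ∀ s, s ≤ a ^ 2 → φ s = 0 := by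
    intro s hs
    have h : ∫ r in (0 : ℝ)..s, (1 - cutoffProfile a b r) / 2 = ∫ r in (0 : ℝ)..s, (0 : ℝ) := by
      refine intervalIntegral.integral_congr fun r hr => ?_
      have hr' : r ≤ a ^ 2 := by
        rcases le_total 0 s with h0s | hs0
        · rw [uIcc_of_le h0s] at hr
          exact hr.2.trans hs
        · rw [uIcc_of_ge hs0] at hr
          exact hr.2.trans (sq_nonneg a)
      rw [cutoffProfile_eq_one ha.le hab hr', sub_self, zero_div]
    simp only [hφ]
    rw [h, intervalIntegral.integral_zero]
  have hφ1 : ContDiff ℝ 1 φ := by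
    rw [contDiff_one_iff_deriv]
    refine ⟨fun s => (hφd s).differentiableAt, ?_⟩
    have hder : deriv φ = fun s => (1 - cutoffProfile a b s) / 2 := funext fun s => (hφd s).deriv
    rw [hder]
    exact hgc
  set H : EuclideanSpace ℝ (Fin 3) → ℝ := fun x => φ (‖curl v x‖ ^ 2) with hH
  have hN1 : ContDiff ℝ 1 fun x => ‖curl v x‖ ^ 2 := hω1.norm_sq ℝ
  have hH1 : ContDiff ℝ 1 H := hφ1.comp hN1
  have hHd : ∀ x, HasFDerivAt H (((1 - cutoffProfile a b (‖curl v x‖ ^ 2)) / 2) •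
      ((2 : ℝ) • (innerSL ℝ (curl v x)).comp (fderiv ℝ (curl v) x))) x := fun x =>
    (hφd _).comp_hasFDerivAt x
      (((hω1.differentiable one_ne_zero x).hasFDerivAt.norm_sq).congr_fderiv
        (by rw [← Nat.cast_smul_eq_nsmul ℝ, Nat.cast_ofNat]))
  have hHv : ∀ x, fderiv ℝ H x (v x) =
      ⟪(1 - radialCutoff a b (curl v x)) • curl v x, convect v (curl v) x⟫ := by
    intro x
    rw [(hHd x).fderiv, real_inner_smul_left, convect, _root_.smul_apply, _root_.smul_apply,
      ContinuousLinearMap.comp_apply, innerSL_apply_apply, smul_eq_mul, smul_eq_mul]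
    simp only [radialCutoff]
    ring
  have hω0 : Tendsto (curl v) (cocompact (EuclideanSpace ℝ (Fin 3))) (𝓝 0) :=
    tendsto_curl_cocompact hv hG hB
  obtain ⟨t, ht, htS⟩ := exists_isCompact_superlevel_subset hω0 ha
  have hHc : HasCompactSupport H := by
    refine HasCompactSupport.of_support_subset_isCompact ht fun x hx => htS ?_
    by_contra h
    have hle : ‖curl v x‖ ≤ a := not_lt.1 h
    exact hx (hφ0 _ (pow_le_pow_left₀ (norm_nonneg _) hle 2))
  have hw1 : ContDiff ℝ 1 fun x => H x • v x := hH1.smul hv1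
  have hwc : HasCompactSupport fun x => H x • v x := hHc.smul_right
  have hdivw : ∀ x, VectorCalculus.divergence (fun y => H y • v y) x = fderiv ℝ H x (v x) := by
    intro x
    rw [divergence_smul_apply ((hH1.differentiable one_ne_zero) x)
      ((hv1.differentiable one_ne_zero) x), hdiv x, mul_zero, zero_add,
      real_inner_comm (gradient H x) (v x)]
    simp only [gradient, InnerProductSpace.toDual_symm_apply]
  calc ∫ x, ⟪(1 - radialCutoff a b (curl v x)) • curl v x, convect v (curl v) x⟫
      = ∫ x, VectorCalculus.divergence (fun y => H y • v y) x :=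
        integral_congr_ae (Eventually.of_forall fun x => ((hdivw x).trans (hHv x)).symm)
    _ = 0 := integral_divergence_eq_zero hw1 hwc

/-! ### §3 Plate L34 -/

/-- **Plate L34 «LambPairingBound» (δ-unfolded).** For `η > 0` there is `C ≥ 0` (depending on `η`
only; `C = 2κ(1 + C_r(1+η)/η)`, `κ = ‖curlCLM‖`, `C_r` the gradient constant of `radialCutoff`) such
that for every level `L > 0` and every admissible field `v` (`C²`, divergence free, `v, ∇v, ∇²v ∈ L²`,
`∇²v` bounded), with `ω = curl v` and the HIGH value cut-off `θ = 1 − radialCutoff L ((1+η)L) ∘ ω`: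
`2∫ θ ⟪ω,(∇v)ω⟫ ≤ C ‖∇ω‖_{L²_F} ‖v × ω‖_{L²({|ω| > L})}`. Lamb form of the stretching with the curl
moved onto the cut vorticity `θω` (transport term = `∫ ∂_v H = 0`, curl self-adjoint on the
compactly supported pair), `curl(θω) = 0` off `{|ω| > L}` and `‖curl(θω)‖ ≤ κ(1 + C_r(1+η)/η)‖∇ω‖`
(the level `L` cancels), Cauchy–Schwarz on `{|ω| > L}`.
[cite: FarhatGrujic2018, §2 (proof of Thm 1: Lamb form (1), identities (3)–(4), low/high split)] -/
theorem lambPairingBound (η : ℝ) (hη : 0 < η) : ∃ C : ℝ, 0 ≤ C ∧ ∀ (L : ℝ), 0 < L →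
    ∀ ⦃v : (EuclideanSpace ℝ (Fin 3)) → (EuclideanSpace ℝ (Fin 3))⦄ (_ : ContDiff ℝ 2 v)
      (_ : VectorCalculus.IsDivFree v)
      (_ : Integrable fun x => ‖v x‖ ^ 2) (_ : Integrable fun x => ‖fderiv ℝ v x‖ ^ 2)
      (_ : Integrable fun x => ‖fderiv ℝ (fderiv ℝ v) x‖ ^ 2)
      (_ : ∃ B : ℝ, ∀ x, ‖fderiv ℝ (fderiv ℝ v) x‖ ≤ B),
      2 * ∫ x, (1 - radialCutoff L ((1 + η) * L) (curl v x)) *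
          ⟪curl v x, fderiv ℝ v x (curl v x)⟫ ≤
        C * Real.sqrt (∫ x, frobeniusNormSq (fderiv ℝ (curl v) x)) *
          Real.sqrt (∫ x in {x | L < ‖curl v x‖}, ‖cross (v x) (curl v x)‖ ^ 2) := by
  obtain ⟨Cr, hCr0, hCr⟩ := exists_norm_fderiv_radialCutoff_le_div (E := EuclideanSpace ℝ (Fin 3))
  set κ : ℝ := ‖(curlCLM : ((EuclideanSpace ℝ (Fin 3)) →L[ℝ] (EuclideanSpace ℝ (Fin 3))) →L[ℝ]
    (EuclideanSpace ℝ (Fin 3)))‖ with hκ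
  have hκ0 : 0 ≤ κ := norm_nonneg _
  set cθ : ℝ := 1 + Cr * (1 + η) / η with hcθ
  have hcθ0 : 0 ≤ cθ := by positivity
  refine ⟨2 * κ * cθ, by positivity, ?_⟩
  intro L hL v hv hdiv _hE hG hH hBex
  obtain ⟨B, hB⟩ := hBex
  have hv1 : ContDiff ℝ 1 v := hv.of_le (by norm_num)
  have hvc : Continuous v := hv.continuous
  have hω1 : ContDiff ℝ 1 (curl v) := contDiff_curl (n := 1) (by exact hv)
  have hωc : Continuous (curl v) := hω1.continuous
  have hDω : Continuous (fderiv ℝ (curl v)) := hω1.continuous_fderiv one_ne_zero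
  have hDωle : ∀ x, ‖fderiv ℝ (curl v) x‖ ≤ κ * ‖fderiv ℝ (fderiv ℝ v) x‖ := fun x => by
    rw [fderiv_curl hv]
    exact ContinuousLinearMap.opNorm_comp_le _ _
  have IDω : Integrable fun x => ‖fderiv ℝ (curl v) x‖ ^ 2 := by
    refine (hH.const_mul (κ ^ 2)).mono' ((hDω.norm.pow 2).aestronglyMeasurable)
      (Eventually.of_forall fun x => ?_)
    rw [Real.norm_of_nonneg (sq_nonneg _), ← mul_pow]
    exact pow_le_pow_left₀ (norm_nonneg _) (hDωle x) 2
  have Ifω : Integrable fun x => frobeniusNormSq (fderiv ℝ (curl v) x) := by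
    refine (IDω.const_mul 3).mono' (continuous_frobeniusNormSq_fderiv hω1 one_ne_zero).aestronglyMeasurable
      (Eventually.of_forall fun x => ?_)
    rw [Real.norm_of_nonneg (frobeniusNormSq_nonneg _)]
    exact frobeniusNormSq_le_three_mul _
  have hω0 : Tendsto (curl v) (cocompact (EuclideanSpace ℝ (Fin 3))) (𝓝 0) :=
    tendsto_curl_cocompact hv hG hB
  set b : ℝ := (1 + η) * L with hb
  have hLb : L < b := by rw [hb]; nlinarith
  set Z : (EuclideanSpace ℝ (Fin 3)) → (EuclideanSpace ℝ (Fin 3)) :=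
    fun y => (1 - radialCutoff L b (curl v y)) • curl v y with hZ
  have hZ1 : ContDiff ℝ 1 Z := contDiff_xHighPart hω1 L b
  have hZc : HasCompactSupport Z := hasCompactSupport_xHighPart hL hLb hω0
  have hZcont : Continuous Z := hZ1.continuous
  have hlayer : 1 + Cr * b / (b - L) = cθ := by
    have hη0 : η ≠ 0 := hη.ne'
    have hL0 : L ≠ 0 := hL.ne'
    rw [show b - L = η * L by rw [hb]; ring, hcθ, hb]
    field_simp
  have hDZ : ∀ y, ‖fderiv ℝ Z y‖ ≤ cθ * ‖fderiv ℝ (curl v) y‖ := fun y => by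
    rw [← hlayer]
    exact norm_fderiv_xHighPart_le hω1 hCr0 hCr hL.le hLb y
  have hcurlZ : ∀ y, ‖curl Z y‖ ≤ κ * cθ * ‖fderiv ℝ (curl v) y‖ := fun y =>
    calc ‖curl Z y‖ ≤ κ * ‖fderiv ℝ Z y‖ := norm_curl_le Z y
      _ ≤ κ * (cθ * ‖fderiv ℝ (curl v) y‖) := mul_le_mul_of_nonneg_left (hDZ y) hκ0
      _ = κ * cθ * ‖fderiv ℝ (curl v) y‖ := by ring
  have hcurlZ0 : ∀ y, ‖curl v y‖ ≤ L → curl Z y = 0 := fun y hy =>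
    curl_xHighPart_eq_zero_of_norm_le hω1 hL.le hLb hy
  have hcurlZc : HasCompactSupport (curl Z) := by
    refine (hZc.fderiv (𝕜 := ℝ)).mono fun y hy h0 => hy ?_
    show curl Z y = 0
    rw [curl_eq_curlCLM, h0, map_zero]
  have hcurlZcont : Continuous (curl Z) := continuous_curl hZ1
  set S : Set (EuclideanSpace ℝ (Fin 3)) := {x | L < ‖curl v x‖} with hS
  have hSm : MeasurableSet S := (isOpen_lt continuous_const hωc.norm).measurableSet
  obtain ⟨t, ht, htS⟩ : ∃ t : Set (EuclideanSpace ℝ (Fin 3)), IsCompact t ∧ S ⊆ t :=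
    exists_isCompact_superlevel_subset hω0 hL
  -- ### the Lamb–transport identity `(∇v)ω = (v·∇)ω − curl(ω × v)`
  have hF1 : ContDiff ℝ 1 fun y => cross (curl v y) (v y) :=
    (crossCLM.contDiff.comp hω1).clm_apply hv1
  have hFc : Continuous fun y => cross (curl v y) (v y) := hF1.continuous
  have hcF : Continuous (curl fun y => cross (curl v y) (v y)) := continuous_curl hF1
  have hpt : ∀ x, fderiv ℝ v x (curl v x) =
      convect v (curl v) x - curl (fun y => cross (curl v y) (v y)) x := by
    intro x
    have h := curl_cross_apply (W := curl v) (Ω := v) (x := x)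
      (hω1.differentiable one_ne_zero x) (hv.differentiable (by norm_num) x)
    rw [divergence_curl_eq_zero_holds v hv x, hdiv x, zero_smul, zero_smul, sub_zero, add_zero] at h
    rw [h, convect]
    abel
  have hFnorm : ∀ y, ‖cross (curl v y) (v y)‖ = ‖cross (v y) (curl v y)‖ := fun y => by
    rw [cross_swap (curl v y) (v y), norm_neg]
  -- ### the weighted integrand is `⟪Z, (v·∇)ω⟫ − ⟪Z, curl(ω × v)⟫`
  have hint : ∀ x, (1 - radialCutoff L b (curl v x)) * ⟪curl v x, fderiv ℝ v x (curl v x)⟫ =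
      ⟪Z x, convect v (curl v) x⟫ - ⟪Z x, curl (fun y => cross (curl v y) (v y)) x⟫ := by
    intro x
    rw [← inner_sub_right, ← hpt x]
    simp only [hZ, real_inner_smul_left]
  have IA : Integrable fun x => ⟪Z x, convect v (curl v) x⟫ :=
    (hZcont.inner (hDω.clm_apply hvc)).integrable_of_hasCompactSupport
      (hZc.mono fun y hy h0 => hy (show ⟪Z y, convect v (curl v) y⟫ = 0 by rw [h0, inner_zero_left]))
  have IB : Integrable fun x => ⟪Z x, curl (fun y => cross (curl v y) (v y)) x⟫ :=
    (hZcont.inner hcF).integrable_of_hasCompactSupport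
      (hZc.mono fun y hy h0 => hy
        (show ⟪Z y, curl (fun y => cross (curl v y) (v y)) y⟫ = 0 by rw [h0, inner_zero_left]))
  have IX : Integrable fun y => cross (Z y) (cross (curl v y) (v y)) :=
    (crossCLM.continuous₂.comp₂ hZcont hFc).integrable_of_hasCompactSupport
      (hZc.mono fun y hy h0 => hy
        (show cross (Z y) (cross (curl v y) (v y)) = 0 by rw [h0, cross_zero_left]))
  have I1 : Integrable fun y => ⟪cross (curl v y) (v y), curl Z y⟫ :=
    (hFc.inner hcurlZcont).integrable_of_hasCompactSupport
      (hcurlZc.mono fun y hy h0 => hy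
        (show ⟪cross (curl v y) (v y), curl Z y⟫ = 0 by rw [h0, inner_zero_right]))
  have hA : ∫ x, ⟪Z x, convect v (curl v) x⟫ = 0 :=
    integral_inner_xHighPart_convect_eq_zero hv hdiv hG hB hL hLb
  have hBterm : ∫ x, ⟪Z x, curl (fun y => cross (curl v y) (v y)) x⟫ =
      ∫ x, ⟪cross (curl v x) (v x), curl Z x⟫ := by
    have h := FarhatGrujic2018.integral_inner_curl_eq_integral_inner_curl_of_integrable hF1 hZ1 IX I1 IB
    rw [← h]
    exact integral_congr_ae (Eventually.of_forall fun x => real_inner_comm _ _)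
  -- ### the left side equals `−2 ∫ ⟪ω × v, curl Z⟫`
  have hLHS : 2 * ∫ x, (1 - radialCutoff L b (curl v x)) * ⟪curl v x, fderiv ℝ v x (curl v x)⟫ =
      -2 * ∫ x, ⟪cross (curl v x) (v x), curl Z x⟫ := by
    rw [integral_congr_ae (Eventually.of_forall hint :
      (fun x => (1 - radialCutoff L b (curl v x)) * ⟪curl v x, fderiv ℝ v x (curl v x)⟫) =ᵐ[volume]
        fun x => ⟪Z x, convect v (curl v) x⟫ - ⟪Z x, curl (fun y => cross (curl v y) (v y)) x⟫),
      integral_sub IA IB, hA, hBterm, zero_sub]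
    ring
  -- ### pointwise bound by the product `1_S ‖v × ω‖ · ‖∇ω‖`
  set f : (EuclideanSpace ℝ (Fin 3)) → ℝ := S.indicator fun y => ‖cross (v y) (curl v y)‖ with hf
  set g : (EuclideanSpace ℝ (Fin 3)) → ℝ := fun y => ‖fderiv ℝ (curl v) y‖ with hg
  have hf0 : ∀ y, 0 ≤ f y := fun y => indicator_nonneg (fun _ _ => norm_nonneg _) _
  have hg0 : ∀ y, 0 ≤ g y := fun y => norm_nonneg _
  have hptB : ∀ y, -⟪cross (curl v y) (v y), curl Z y⟫ ≤ κ * cθ * (f y * g y) := by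
    intro y
    by_cases hy : y ∈ S
    · have hfy : f y = ‖cross (v y) (curl v y)‖ := by rw [hf, indicator_of_mem hy]
      rw [hfy, hg]
      calc -⟪cross (curl v y) (v y), curl Z y⟫ ≤ |⟪cross (curl v y) (v y), curl Z y⟫| := neg_le_abs _
        _ ≤ ‖cross (curl v y) (v y)‖ * ‖curl Z y‖ := abs_real_inner_le_norm _ _
        _ ≤ ‖cross (v y) (curl v y)‖ * (κ * cθ * ‖fderiv ℝ (curl v) y‖) := by
            rw [hFnorm y]
            exact mul_le_mul_of_nonneg_left (hcurlZ y) (norm_nonneg _)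
        _ = κ * cθ * (‖cross (v y) (curl v y)‖ * ‖fderiv ℝ (curl v) y‖) := by ring
    · have hy' : ‖curl v y‖ ≤ L := not_lt.1 hy
      rw [hcurlZ0 y hy', inner_zero_right, neg_zero]
      exact mul_nonneg (mul_nonneg hκ0 hcθ0) (mul_nonneg (hf0 y) (hg0 y))
  have hXc : Continuous fun y => ‖cross (v y) (curl v y)‖ := (crossCLM.continuous₂.comp₂ hvc hωc).norm
  have Ifg : Integrable fun y => f y * g y := by
    have heq : (fun y => f y * g y) =
        S.indicator (fun y => ‖cross (v y) (curl v y)‖ * ‖fderiv ℝ (curl v) y‖) := by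
      funext y
      by_cases hy : y ∈ S
      · rw [indicator_of_mem hy, hf, indicator_of_mem hy]
      · rw [indicator_of_notMem hy, hf, indicator_of_notMem hy, zero_mul]
    rw [heq, integrable_indicator_iff hSm]
    exact ((hXc.mul hDω.norm).continuousOn.integrableOn_compact ht).mono_set htS
  have hf2S : (fun y => f y ^ 2) = S.indicator (fun y => ‖cross (v y) (curl v y)‖ ^ 2) := by
    funext y
    by_cases hy : y ∈ S
    · rw [indicator_of_mem hy, hf, indicator_of_mem hy]
    · rw [indicator_of_notMem hy, hf, indicator_of_notMem hy]; ring
  have If2 : Integrable fun y => f y ^ 2 := by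
    rw [hf2S, integrable_indicator_iff hSm]
    exact ((hXc.pow 2).continuousOn.integrableOn_compact ht).mono_set htS
  have hfm : AEStronglyMeasurable f volume := hXc.aestronglyMeasurable.indicator hSm
  have hf2 : MemLp f 2 volume := (memLp_two_iff_integrable_sq hfm).2 If2
  have hg2 : MemLp g 2 volume := (memLp_two_iff_integrable_sq hDω.norm.aestronglyMeasurable).2 IDω
  have hCS := integral_mul_le_sqrt_mul_sqrt' hf0 hg0 hf2 hg2
  have hf2eq : ∫ y, f y ^ 2 = ∫ x in S, ‖cross (v x) (curl v x)‖ ^ 2 := by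
    rw [hf2S, integral_indicator hSm]
  have hg2le : Real.sqrt (∫ y, g y ^ 2) ≤ Real.sqrt (∫ x, frobeniusNormSq (fderiv ℝ (curl v) x)) :=
    Real.sqrt_le_sqrt (integral_mono IDω Ifω fun x => sq_opNorm_le_frobeniusNormSq _)
  have hmain : -∫ x, ⟪cross (curl v x) (v x), curl Z x⟫ ≤ κ * cθ * ∫ y, f y * g y := by
    rw [← integral_neg, ← integral_const_mul]
    exact integral_mono I1.neg (Ifg.const_mul _) hptB
  calc 2 * ∫ x, (1 - radialCutoff L b (curl v x)) * ⟪curl v x, fderiv ℝ v x (curl v x)⟫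
      = 2 * (-∫ x, ⟪cross (curl v x) (v x), curl Z x⟫) := by rw [hLHS]; ring
    _ ≤ 2 * (κ * cθ * ∫ y, f y * g y) := by gcongr
    _ ≤ 2 * (κ * cθ * (Real.sqrt (∫ y, f y ^ 2) * Real.sqrt (∫ y, g y ^ 2))) := by gcongr
    _ ≤ 2 * (κ * cθ * (Real.sqrt (∫ x in S, ‖cross (v x) (curl v x)‖ ^ 2) *
          Real.sqrt (∫ x, frobeniusNormSq (fderiv ℝ (curl v) x)))) := by
        rw [hf2eq]; gcongr
    _ = 2 * κ * cθ * Real.sqrt (∫ x, frobeniusNormSq (fderiv ℝ (curl v) x)) *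
          Real.sqrt (∫ x in S, ‖cross (v x) (curl v x)‖ ^ 2) := by ring

/-- **Plate L34 «LambPairingBound», BY NAME** against the texts of record (P0 `IntenseSetDoorsDefs`).
[cite: FarhatGrujic2018, §2 (proof of Thm 1: Lamb form, curl onto the cut vorticity)] -/
theorem lambPairingBound_holds : LambPairingBound := fun η hη => lambPairingBound η hη

end Summit.NavierStokesRegularity.NavierStokesRegularity.Theorems.IntenseSetDoors

end
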